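import Summits.ValiantsHypothesis.ValiantsHypothesis.Theses.ScaledPencil
import Summits.ValiantsHypothesis.ValiantsHypothesis.Theorems.ScaledPencilPencilOfAffine
import Summits.ValiantsHypothesis.ValiantsHypothesis.Theorems.ScaledPencilScaledSameSize
import Summits.ValiantsHypothesis.ValiantsHypothesis.Theorems.ScaledPencilMinimalRepStable

/-!
# Crux `NormalForm` (stmt-ValiantsHypothesis-5317) — line `support-split`

Skeleton of the typed decomposition `NormalForm ⇐ PencilOfAffine ∧ ScaledSameSize ∧ MinimalRepStable`
(crux-strategist unit `cstrat-stmt-ValiantsHypothesis-5317-r1`, BC2 redirect of the route re-audit).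
The three stubs ARE the route's support items stmt-5322 / stmt-5320 / stmt-5321, all proved in the
tree, so every stub below is closed by its landed theorem (no `sorry` anywhere) and the composition
`NormalForm_of` proves the crux: `NormalForm_closed : NormalForm`.

* `stub_pencilOfAffine`   — bookkeeping `HasDetRepr per_n m ↔ ∃ pencil (Λ, L) of size m`;
* `stub_scaledSameSize`   — analytic half (Kempf–Ness first-order condition on the closed fibre):
  a pencil computing `per_n` has an operator-scaled, torus-balanced pencil of the SAME size;
* `stub_minimalRepStable` — algebraic half (block-triangularisation + irreducibility of `per_n`):
  at minimal size every pencil computing `per_n` is θ-stable.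

`NormalForm_of`: descend to the minimal size `m₀ = Nat.find (∃ k, HasDetRepr per_n k) ≤ m`, take a
pencil there, rescale it at the same size (minimality preserved), read off stability from
minimality.  The same proof, packaged for `Theorems/ScaledPencilNormalFormSplit.lean`, is attached to
the item as a candidate proof (planners cannot write `Theorems/`, D-0016).
-/

set_option linter.dupNamespace false

namespace Summit.ValiantsHypothesis.ValiantsHypothesis.Cruxes.NormalForm.SupportSplit

open Literature.Computability.AlgebraicComplexity
open Summit.ValiantsHypothesis.ValiantsHypothesis.Theses.ScaledPencil
open Summit.ValiantsHypothesis.ValiantsHypothesis.Theorems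

/-- Stub 1 (= item stmt-ValiantsHypothesis-5322, PROVED): pencil form of affine determinantal
representations of `per_n`. -/
theorem stub_pencilOfAffine : PencilOfAffine :=
  pencilOfAffine_proof

/-- Stub 2 (= item stmt-ValiantsHypothesis-5320, PROVED): same-size operator scaling + torus
balancing inside the closed fibre `{det = per_n}`. -/
theorem stub_scaledSameSize : ScaledSameSize :=
  Summit.ValiantsHypothesis.Theorems.scaledSameSize_proof

/-- Stub 3 (= item stmt-ValiantsHypothesis-5321, PROVED): θ-stability of every pencil computing
`per_n` at minimal size. -/
theorem stub_minimalRepStable : MinimalRepStable :=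
  minimalRepStable_proof

/-- Composition (kernel-checked, concludes the crux BY NAME): minimal size via `Nat.find`, pencil
form, same-size rescaling, stability from minimality. -/
theorem NormalForm_of :
    PencilOfAffine → ScaledSameSize → MinimalRepStable →
      Summit.ValiantsHypothesis.ValiantsHypothesis.Theses.ScaledPencil.NormalForm := by
  intro hPencil hScaled hStable n m hm
  classical
  -- the minimal size of an affine determinantal representation of `per_n` (exists since `m` is one)
  have hex : ∃ k, HasDetRepr (perPoly (Fin n) ℂ) k := ⟨m, hm⟩
  obtain ⟨hm₀, hmin⟩ :
      HasDetRepr (perPoly (Fin n) ℂ) (Nat.find hex) ∧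
        ∀ m' < Nat.find hex, ¬ HasDetRepr (perPoly (Fin n) ℂ) m' :=
    ⟨Nat.find_spec hex, fun m' h => Nat.find_min hex h⟩
  have hle : Nat.find hex ≤ m := Nat.find_min' hex hm
  -- a pencil of minimal size (bookkeeping `HasDetRepr ↔ pencil`)
  obtain ⟨Λ, L, hdet⟩ := (hPencil n (Nat.find hex)).mp hm₀
  -- rescale inside the closed fibre `{det = per_n}` without changing the size (analytic half)
  obtain ⟨Λ', L', hdet', hscaled⟩ := hScaled n (Nat.find hex) Λ L hdet
  -- at minimal size the rescaled pencil is θ-stable (algebraic half); assemble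
  exact ⟨Nat.find hex, hle, Λ', L', hdet', hscaled,
    hStable n (Nat.find hex) hmin Λ' L' hdet'⟩

/-- The crux is closed along this line: every stub is proved. -/
theorem NormalForm_closed :
    Summit.ValiantsHypothesis.ValiantsHypothesis.Theses.ScaledPencil.NormalForm :=
  NormalForm_of stub_pencilOfAffine stub_scaledSameSize stub_minimalRepStable

end Summit.ValiantsHypothesis.ValiantsHypothesis.Cruxes.NormalForm.SupportSplit
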